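import Summits.AnomalousDissipation.AnomalousDissipation.Theorems.MomentParityResolvedDissipationTrajectoryUILocalWindow
import Summits.AnomalousDissipation.AnomalousDissipation.Theorems.MomentParityResolvedDissipationStubPathwiseDissipation
import HarnessLib

/-!
# Stub `stub_pathwiseFGT` for line `enstrophy-ui-transfer`
# (crux `MomentParity.ResolvedDissipation`, stmt-AnomalousDissipation-14284)

Supports stmt-AnomalousDissipation-14284 (stub stub_pathwiseFGT for line enstrophy-ui-transfer, lead c7).
Nothing here closes an item.

S10 of skeleton v8 (lead c7): the `N`-UNIFORM PATHWISE Foias–Guillopé–Temam bound along Galerkin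
orbits of the 3-D Navier–Stokes Galerkin system of order `N` on `T³` (steady smooth mean-zero force
`f`, viscosity `ν > 0`): for every radius `R` and window `T ≥ 0` there is ONE finite `C = C(ν, f, R, T)`
with `∫₀ᵀ ‖ΔS^N_t a‖² / (1 + ‖∇S^N_t a‖²)² dt ≤ C` for every order `N` and every mean-zero Galerkin
mode `a` of order `N` with `∫‖a‖² ≤ R²` ("no escape in wavenumber at bounded enstrophy").

Proof.
* Along the coefficient orbit `β` (`isGalerkinODESolution_galerkinCoeffFlow`,
  `IsGalerkinMode.galerkinFlow_eq`) the enstrophy `Z = ‖∇u‖₂²` has right derivative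
  `2(∫⟪Δu,(u·∇)u⟫ − ν‖Δu‖₂² − ∫⟪P_N f, Δu⟫)` (`hasDerivWithinAt_enstrophy`).
* The landed `N`-uniform generator bound `TrajectoryUILocalWindow.galerkin_generator_enstrophy_le`
  applied at viscosity `ν/2` keeps half of the dissipative term:
  `Z' ≤ −ν‖Δu‖₂² + A Z³ + B`, `A = 27C₀⁴/(16(ν/2)³)`, `B = ‖f‖₂²/(ν/2)`, `C₀` the sharp Agmon
  constant (`StretchingBound.norm_realTrigPoly_le_sharpAgmon`); the mean mode stays `0`
  (`ZeroMeanFlow.stub_zeroMean_galerkinFlow`).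
* `fgt_integral_bound`: the weight `W = −(1+Z)⁻¹` has right derivative `Z'/(1+Z)² ≤ −ν P/(1+Z)² + A Z + B`
  (`P = ‖Δu‖₂²`), so integrating (`intervalIntegral.sub_le_integral_of_hasDeriv_right_of_le_Ico`)
  `ν ∫₀ᵀ P/(1+Z)² ≤ 1 + A ∫₀ᵀ Z + B T`.
* `∫₀ᵀ Z ≤ (∫‖a‖² + T‖f‖₂²/(4π²ν))/ν ≤ (R² + T‖f‖₂²/(4π²ν))/ν` is the landed pathwise energy bound
  `PathwiseDissipation.stub_pathwiseDissipation`.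
* The `ℝ≥0∞` integrand is `ofReal (P/(1+Z)²)` of a continuous function, so the lintegral is the honest
  integral (`lintegral_Ioo_ofReal_eq`, `fgt_integrand_ofReal`).

References: Foias–Guillopé–Temam 1981; Foias–Manley–Rosa–Temam 2001, Ch. II App. A (A.55)–(A.60);
Constantin–Foias 1988, Ch. 10.
-/

noncomputable section

set_option linter.dupNamespace false

namespace Summit.AnomalousDissipation.AnomalousDissipation.Theorems.MomentParityResolvedDissipation.PathwiseFGT

open MeasureTheory Filter Topology Set UnitAddTorus
open scoped ENNReal InnerProductSpace RealInnerProductSpace BigOperators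
open Literature.Analysis.FunctionSpaces Literature.Analysis.FunctionSpaces.Torus
open Literature.Analysis.FluidPDE Literature.Analysis.FluidPDE.Torus
open Summit.AnomalousDissipation.AnomalousDissipation.Theorems.CubicParityLoud.Negative (T3 R3)

/-! ## Real calculus: integrating the enstrophy inequality against the FGT weight -/

/-- **Foias–Guillopé–Temam integration.** Let `Z ≥ 0` be continuous on `[0, T]` with right derivative
`2(X − νP − Y)` on `[0, T)`, where `2(X − (ν/2)P − Y) ≤ A Z³ + B` (`A, B ≥ 0`) and `P = Q` is continuous
on `[0, T]`. Then `ν ∫₀ᵀ Q/(1+Z)² ≤ 1 + A ∫₀ᵀ Z + B T`: the weight `W = −(1+Z)⁻¹ ∈ [−1, 0)` has right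
derivative `Z'/(1+Z)² ≤ −ν Q/(1+Z)² + A Z + B` (as `Z³ ≤ Z(1+Z)²`, `1 ≤ (1+Z)²`), and one integrates
(`intervalIntegral.sub_le_integral_of_hasDeriv_right_of_le_Ico`). [cite: FMRTTurbulence2001, Ch. II App. A (A.55)–(A.60)] -/
theorem fgt_integral_bound {Z P Q X Y : ℝ → ℝ} {T ν A B : ℝ} (hT : 0 ≤ T)
    (hA : 0 ≤ A) (hB : 0 ≤ B) (hZc : ContinuousOn Z (Icc 0 T)) (hPQ : ∀ s, P s = Q s)
    (hQc : ContinuousOn Q (Icc 0 T)) (hZ0 : ∀ s, 0 ≤ Z s)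
    (hderiv : ∀ s ∈ Ico 0 T, HasDerivWithinAt Z (2 * (X s - ν * P s - Y s)) (Ici s) s)
    (hgen : ∀ s ∈ Ico 0 T, 2 * (X s - ν / 2 * P s - Y s) ≤ A * Z s ^ 3 + B) :
    ν * ∫ s in (0:ℝ)..T, Q s / (1 + Z s) ^ 2 ≤ 1 + A * (∫ s in (0:ℝ)..T, Z s) + B * T := by
  -- the Foias–Guillopé–Temam weight `W = -(1 + Z)⁻¹`
  have h1Z : ∀ s, 0 < 1 + Z s := fun s => by linarith [hZ0 s]
  have hWc : ContinuousOn (fun s => -(1 + Z s)⁻¹) (Icc 0 T) :=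
    ((continuousOn_const.add hZc).inv₀ fun s _ => (h1Z s).ne').neg
  have hWd : ∀ s ∈ Ico 0 T, HasDerivWithinAt (fun s => -(1 + Z s)⁻¹)
      (2 * (X s - ν * P s - Y s) / (1 + Z s) ^ 2) (Ioi s) s := by
    intro s hs
    have h := (((hderiv s hs).const_add 1).inv (h1Z s).ne').neg
    refine (h.mono Ioi_subset_Ici_self).congr_deriv ?_
    rw [neg_div, neg_neg]
  -- the comparison integrand `φ = -ν Q/(1+Z)² + A Z + B`
  have hq0 : ∀ s, 0 < (1 + Z s) ^ 2 := fun s => pow_pos (h1Z s) 2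
  have hqc : ContinuousOn (fun s => Q s / (1 + Z s) ^ 2) (Icc 0 T) :=
    hQc.div ((continuousOn_const.add hZc).pow 2) fun s _ => (hq0 s).ne'
  have hφc : ContinuousOn (fun s => -ν * (Q s / (1 + Z s) ^ 2) + A * Z s + B) (Icc 0 T) :=
    ((continuousOn_const.mul hqc).add (continuousOn_const.mul hZc)).add continuousOn_const
  have hφg : ∀ s ∈ Ico 0 T, 2 * (X s - ν * P s - Y s) / (1 + Z s) ^ 2 ≤
      -ν * (Q s / (1 + Z s) ^ 2) + A * Z s + B := by
    intro s hs
    have hq1 : 1 ≤ (1 + Z s) ^ 2 := one_le_pow₀ (by linarith [hZ0 s])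
    rw [div_le_iff₀ (hq0 s), ← hPQ s]
    have hqne : (1 + Z s) ^ 2 ≠ 0 := (hq0 s).ne'
    have hcancel : P s / (1 + Z s) ^ 2 * (1 + Z s) ^ 2 = P s := div_mul_cancel₀ _ hqne
    have hid : (-ν * (P s / (1 + Z s) ^ 2) + A * Z s + B) * (1 + Z s) ^ 2 =
        -ν * P s + A * (Z s * (1 + Z s) ^ 2) + B * (1 + Z s) ^ 2 := by
      calc (-ν * (P s / (1 + Z s) ^ 2) + A * Z s + B) * (1 + Z s) ^ 2
          = -ν * (P s / (1 + Z s) ^ 2 * (1 + Z s) ^ 2) + A * (Z s * (1 + Z s) ^ 2) +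
              B * (1 + Z s) ^ 2 := by ring
        _ = -ν * P s + A * (Z s * (1 + Z s) ^ 2) + B * (1 + Z s) ^ 2 := by rw [hcancel]
    rw [hid]
    have h2 : Z s ^ 3 ≤ Z s * (1 + Z s) ^ 2 := by nlinarith [hZ0 s]
    have h3 : B ≤ B * (1 + Z s) ^ 2 := le_mul_of_one_le_right hB hq1
    nlinarith [hgen s hs, mul_le_mul_of_nonneg_left h2 hA, h3]
  -- integrate over `[0, T]`
  have hmain : -(1 + Z T)⁻¹ - -(1 + Z 0)⁻¹ ≤
      ∫ s in (0:ℝ)..T, (-ν * (Q s / (1 + Z s) ^ 2) + A * Z s + B) :=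
    intervalIntegral.sub_le_integral_of_hasDeriv_right_of_le_Ico hT hWc hWd hφc.integrableOn_Icc hφg
  have hQi : IntervalIntegrable (fun s => Q s / (1 + Z s) ^ 2) volume 0 T :=
    hqc.intervalIntegrable_of_Icc hT
  have hZi : IntervalIntegrable Z volume 0 T := hZc.intervalIntegrable_of_Icc hT
  have hφint : ∫ s in (0:ℝ)..T, (-ν * (Q s / (1 + Z s) ^ 2) + A * Z s + B) =
      -ν * (∫ s in (0:ℝ)..T, Q s / (1 + Z s) ^ 2) + A * (∫ s in (0:ℝ)..T, Z s) + B * T := by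
    rw [intervalIntegral.integral_add ((hQi.const_mul _).add (hZi.const_mul _))
        intervalIntegrable_const,
      intervalIntegral.integral_add (hQi.const_mul _) (hZi.const_mul _),
      intervalIntegral.integral_const_mul, intervalIntegral.integral_const_mul,
      intervalIntegral.integral_const, smul_eq_mul, sub_zero]
    ring
  have hW0 : 0 ≤ (1 + Z 0)⁻¹ := inv_nonneg.2 (h1Z 0).le
  have hWT : (1 + Z T)⁻¹ ≤ 1 := inv_le_one_of_one_le₀ (by linarith [hZ0 T])
  rw [hφint] at hmain
  linarith

/-! ## `ℝ≥0∞` bookkeeping -/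

/-- The lintegral over `(0, T)` of `ofReal` of a nonnegative function continuous on `[0, T]` is `ofReal`
of its interval integral. [folklore] -/
theorem lintegral_Ioo_ofReal_eq {g : ℝ → ℝ} {T : ℝ} (hT : 0 ≤ T) (hgc : ContinuousOn g (Icc 0 T))
    (hg0 : ∀ t, 0 ≤ g t) :
    ∫⁻ t in Ioo 0 T, ENNReal.ofReal (g t) = ENNReal.ofReal (∫ t in (0:ℝ)..T, g t) := by
  have hint : IntegrableOn g (Ioo 0 T) volume := hgc.integrableOn_Icc.mono_set Ioo_subset_Icc_self
  rw [intervalIntegral.integral_of_le hT, integral_Ioc_eq_integral_Ioo,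
    ofReal_integral_eq_lintegral_ofReal hint (ae_of_all _ hg0)]

/-- The FGT integrand in `ℝ≥0∞`: `ofReal p / (1 + ofReal z)² = ofReal (p/(1+z)²)` for `z ≥ 0`.
[folklore] -/
theorem fgt_integrand_ofReal (p : ℝ) {z : ℝ} (hz : 0 ≤ z) :
    ENNReal.ofReal p / (1 + ENNReal.ofReal z) ^ 2 = ENNReal.ofReal (p / (1 + z) ^ 2) := by
  rw [ENNReal.ofReal_div_of_pos (by positivity), ENNReal.ofReal_pow (by positivity),
    ENNReal.ofReal_add zero_le_one hz, ENNReal.ofReal_one]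

/-! ## The registered stub -/

/-- **S10 · `stub_pathwiseFGT` — the `N`-uniform pathwise Foias–Guillopé–Temam bound along Galerkin
orbits.** For `ν > 0`, a smooth mean-zero force `f`, a radius `R` and a window `T ≥ 0` there is ONE
finite `C` such that for EVERY order `N` and every mean-zero Galerkin mode `a` of order `N` with
`∫‖a‖² ≤ R²`, `∫₀ᵀ ‖ΔS^N_t a‖² / (1 + ‖∇S^N_t a‖²)² dt ≤ C`. Explicitly
`C = ofReal ((1 + A (R² + T‖f‖₂²/(4π²ν))/ν + B T)/ν)`, `A = 27C₀⁴/(16(ν/2)³)`, `B = ‖f‖₂²/(ν/2)`,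
`C₀` the sharp Agmon constant. Proof: the enstrophy identity along the coefficient orbit
(`hasDerivWithinAt_enstrophy`), the `N`-uniform generator bound
`TrajectoryUILocalWindow.galerkin_generator_enstrophy_le` at viscosity `ν/2` (dissipative term kept,
mean mode `0` by `ZeroMeanFlow.stub_zeroMean_galerkinFlow`), the FGT integration `fgt_integral_bound`,
and the pathwise energy bound `PathwiseDissipation.stub_pathwiseDissipation` for `∫₀ᵀ ‖∇S_t a‖²`.
[cite: FMRTTurbulence2001, Ch. II App. A (A.55)–(A.60)] -/
theorem stub_pathwiseFGT (ν : ℝ) (hν : 0 < ν) (f : T3 → R3) (hf : Torus.IsSmooth f)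
    (hf0 : Torus.HasZeroMean f) (R T : ℝ) (hT : 0 ≤ T) :
    ∃ C : ℝ≥0∞, C ≠ ⊤ ∧ ∀ (N : ℕ) (a : T3 → R3), IsGalerkinMode N a → Torus.HasZeroMean a →
      ∫ x, ‖a x‖ ^ 2 ≤ R ^ 2 →
      ∫⁻ t in Set.Ioo 0 T, eLaplacianNormSq (Torus.galerkinFlow ν f N t a) /
          (1 + Torus.eGradNormSq (Torus.galerkinFlow ν f N t a)) ^ 2 ≤ C := by
  obtain ⟨C₀, hC₀, hAg⟩ := StretchingBound.norm_realTrigPoly_le_sharpAgmon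
  -- the `N`-uniform constants
  have hF20 : 0 ≤ ∫ x, ‖f x‖ ^ 2 := integral_nonneg fun _ => sq_nonneg _
  have hA0 : 0 ≤ 27 * C₀ ^ 4 / (16 * (ν / 2) ^ 3) := by positivity
  have hB0 : 0 ≤ (∫ x, ‖f x‖ ^ 2) / (ν / 2) := by positivity
  refine ⟨ENNReal.ofReal ((1 + 27 * C₀ ^ 4 / (16 * (ν / 2) ^ 3) *
      ((R ^ 2 + T * (∫ x, ‖f x‖ ^ 2) / (4 * Real.pi ^ 2 * ν)) / ν) +
      (∫ x, ‖f x‖ ^ 2) / (ν / 2) * T) / ν), ENNReal.ofReal_ne_top, fun N a ha ha0 haR => ?_⟩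
  -- the coefficient orbit
  have hS : ∀ k ∈ freqBall (d := Fin 3) N, -k ∈ freqBall N := neg_mem_freqBall_of_mem
  have hfm : MemLp f 2 volume := hf.memLp 2
  have hg : IsRealCoeff (fourierRestrict (freqBall N) f) :=
    isRealCoeff_mFourierCoeff (hfm.integrable one_le_two)
  have hc : fourierRestrict (freqBall N) a ∈ galerkinSubspace (freqBall N) := ha.fourierRestrict_mem
  set β : ℝ → ↥(freqBall (d := Fin 3) N) → EuclideanSpace ℂ (Fin 3) :=
    fun s => galerkinCoeffFlow ν (fourierRestrict (freqBall N) f) s (fourierRestrict (freqBall N) a)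
  have hsol : IsGalerkinODESolution ν (fourierRestrict (freqBall N) f) (fourierRestrict (freqBall N) a) β :=
    isGalerkinODESolution_galerkinCoeffFlow hν.le hS hg hc
  have hflow : ∀ s, galerkinFlow ν f N s a = realTrigPoly (freqBall N) (coeffExt (freqBall N) (β s)) :=
    fun s => ha.galerkinFlow_eq s
  -- the enstrophy `Zr` and the palinstrophy `Pr` of the orbit, as real functions of time
  set Zr : ℝ → ℝ := fun s => 4 * Real.pi ^ 2 *
    ∑ k : ↥(freqBall (d := Fin 3) N), freqNormSq (k : Fin 3 → ℤ) * ‖β s k‖ ^ 2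
  set Pr : ℝ → ℝ := fun s => 16 * Real.pi ^ 4 *
    ∑ k : ↥(freqBall (d := Fin 3) N), freqNormSq (k : Fin 3 → ℤ) ^ 2 * ‖β s k‖ ^ 2
  have hZr_of : ∀ s, eGradNormSq (galerkinFlow ν f N s a) = ENNReal.ofReal (Zr s) := fun s => by
    rw [hflow s]
    exact eGradNormSq_coeffExt hS (hsol.mem s).1
  have hPr_eq : ∀ s,
      (eLaplacianNormSq (realTrigPoly (freqBall N) (coeffExt (freqBall N) (β s)))).toReal = Pr s :=
    fun s => toReal_eLaplacianNormSq_coeffExt hS (hsol.mem s).1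
  have hPr_of : ∀ s, eLaplacianNormSq (galerkinFlow ν f N s a) = ENNReal.ofReal (Pr s) := fun s => by
    rw [hflow s]
    exact eLaplacianNormSq_coeffExt hS (hsol.mem s).1
  have hZr0 : ∀ s, 0 ≤ Zr s := fun s => mul_nonneg (by positivity)
    (Finset.sum_nonneg fun k _ => mul_nonneg (freqNormSq_nonneg _) (sq_nonneg _))
  have hPr0 : ∀ s, 0 ≤ Pr s := fun s => mul_nonneg (by positivity)
    (Finset.sum_nonneg fun k _ => mul_nonneg (sq_nonneg _) (sq_nonneg _))
  -- continuity on `[0, T]`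
  have hβc : ContinuousOn β (Icc 0 T) := hsol.continuousOn.mono Icc_subset_Ici_self
  have hZc : ContinuousOn Zr (Icc 0 T) := by
    refine continuousOn_const.mul (continuousOn_finsetSum _ fun k _ => continuousOn_const.mul ?_)
    exact (((continuous_apply k).comp_continuousOn hβc).norm).pow 2
  have hPc : ContinuousOn Pr (Icc 0 T) := by
    refine continuousOn_const.mul (continuousOn_finsetSum _ fun k _ => continuousOn_const.mul ?_)
    exact (((continuous_apply k).comp_continuousOn hβc).norm).pow 2
  -- the mean mode vanishes along the orbit
  have hmean : ∀ s, 0 ≤ s → coeffExt (freqBall N) (β s) 0 = 0 := by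
    intro s hs
    have h0 := mFourierCoeff_complexify_eq_zero_of_hasZeroMean
      (ZeroMeanFlow.stub_zeroMean_galerkinFlow ν hν.le f hf hf0 N a ha ha0 s hs)
    rw [hflow s, mFourierCoeff_realTrigPoly hS ((hsol.mem s).1.isConjSymm_coeffExt hS),
      if_pos (zero_mem_freqBall N)] at h0
    exact h0
  -- the enstrophy identity and the `N`-uniform generator bound at viscosity `ν/2`
  have hderiv := fun s (hs : s ∈ Ico 0 T) =>
    hasDerivWithinAt_enstrophy ν hS (hsol.hasDerivWithinAt_Ici hs) (hsol.mem s) hg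
  have hgen := fun s (hs : s ∈ Ico 0 T) =>
    TrajectoryUILocalWindow.galerkin_generator_enstrophy_le (half_pos hν) hC₀ hAg hfm (hsol.mem s)
      (hmean s hs.1)
  -- integrate against the FGT weight
  have hkey := fgt_integral_bound hT hA0 hB0 hZc hPr_eq hPc hZr0 hderiv hgen
  -- the time-integrated enstrophy from the pathwise energy inequality
  have hzm : ∀ t : ℝ, 0 ≤ t → HasZeroMean (galerkinFlow ν f N t a) :=
    ZeroMeanFlow.stub_zeroMean_galerkinFlow ν hν.le f hf hf0 N a ha ha0
  have hdiss := PathwiseDissipation.stub_pathwiseDissipation ν hν f hf N a ha hzm T hT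
  have hZint : ∫⁻ t in Ioo 0 T, eGradNormSq (galerkinFlow ν f N t a) =
      ENNReal.ofReal (∫ t in (0:ℝ)..T, Zr t) := by
    simp_rw [hZr_of]
    exact lintegral_Ioo_ofReal_eq hT hZc hZr0
  have hai : Integrable (fun x => ‖a x‖ ^ 2) volume :=
    (ha.isSmooth.memLp 2).integrable_norm_pow two_ne_zero
  have ha2 : 0 ≤ ∫ x, ‖a x‖ ^ 2 := integral_nonneg fun _ => sq_nonneg _
  have hconst : ∫ x, ‖a x‖ ^ 2 + T * (∫ x, ‖f x‖ ^ 2) / (4 * Real.pi ^ 2 * ν) =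
      (∫ x, ‖a x‖ ^ 2) + T * (∫ x, ‖f x‖ ^ 2) / (4 * Real.pi ^ 2 * ν) := by
    rw [integral_add hai (integrable_const _), integral_const, probReal_univ, one_smul]
  rw [hZint, hconst] at hdiss
  have hD0 : 0 ≤ ((∫ x, ‖a x‖ ^ 2) + T * (∫ x, ‖f x‖ ^ 2) / (4 * Real.pi ^ 2 * ν)) / ν := by
    positivity
  have hZle : ∫ t in (0:ℝ)..T, Zr t ≤ (R ^ 2 + T * (∫ x, ‖f x‖ ^ 2) / (4 * Real.pi ^ 2 * ν)) / ν :=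
    ((ENNReal.ofReal_le_ofReal_iff hD0).1 hdiss).trans (by gcongr)
  -- the weighted palinstrophy integral is an honest integral
  have hqc : ContinuousOn (fun s => Pr s / (1 + Zr s) ^ 2) (Icc 0 T) :=
    hPc.div ((continuousOn_const.add hZc).pow 2) fun s _ => (pow_pos (by linarith [hZr0 s]) 2).ne'
  have hI : ∫⁻ t in Ioo 0 T, eLaplacianNormSq (galerkinFlow ν f N t a) /
      (1 + eGradNormSq (galerkinFlow ν f N t a)) ^ 2 =
      ENNReal.ofReal (∫ t in (0:ℝ)..T, Pr t / (1 + Zr t) ^ 2) := by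
    simp_rw [hPr_of, hZr_of, fgt_integrand_ofReal _ (hZr0 _)]
    exact lintegral_Ioo_ofReal_eq hT hqc fun t => div_nonneg (hPr0 t) (sq_nonneg _)
  -- conclusion
  rw [hI]
  refine ENNReal.ofReal_le_ofReal ?_
  rw [le_div_iff₀ hν]
  have hAZ := mul_le_mul_of_nonneg_left hZle hA0
  linarith

end Summit.AnomalousDissipation.AnomalousDissipation.Theorems.MomentParityResolvedDissipation.PathwiseFGT

end
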